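import Mathlib
import Summits.ValiantsHypothesis.ValiantsHypothesis.Theorems.NewtonUnitEquationsDissociatedUniformTotalsLawUphillFlow
import HarnessLib

/-!
# Crux `NewtonUnitEquations.DissociatedUniform` (stmt-ValiantsHypothesis-5905): the union totals law for labellings of bounded MODALITY

Companion of `…TotalsLawUphillFlow` (`localMax`, `localMaxPairs`, and the unconditional bound
`unionTotal_le_of_localMaxPairs : UT ≤ q·#localMaxPairs + #bdry Z·V_P` for every labelled pair).  Here the count promised in memo
`Cruxes/DissociatedUniform/NOTES-t1g5.md` §4(D): if along every chart weight `(±1, t)` the label sequences `x ↦ ⟨w, a x⟩`,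
`y ↦ ⟨w, b y⟩` have at most `k_A`, `k_B` label-local maxima (MODALITY `k_A`, `k_B`; convexly ordered strictly convex curves have
modality `1`), then `#localMaxPairs ≤ 2 (k_A + k_B) q`, hence
**`unionTotal_le_of_modality`**: `UT ≤ 2 (k_A + k_B) q² + #bdry Z · V_P` — the constant of the union law on few-run position sets
interpolates linearly in the modality of the labelling between the convexly ordered stratum and the (void) general case.
* `card_inter_pairs_le` (abstract): two finite families of order-connected subsets of `ℝ` with plies `≤ k`, `≤ k'` have at most
  `k'·#I + k·#K` intersecting pairs (charge a pair to the later of the two first witnessed times).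
* `ordConnected_localMaxTimes`: the times at which a label is a local maximum along a chart form an order-connected set (two
  affine sign conditions).
Honest label: stratum theorem (bounded modality, few runs); the laws for general labellings remain OPEN; nothing here bears on
VP ≠ VNP.
[folklore: two interval families of bounded ply have linearly many intersecting pairs]
-/

set_option linter.dupNamespace false -- `ValiantsHypothesis.ValiantsHypothesis` (summit = problem) in every name

open scoped BigOperators

namespace Summit.ValiantsHypothesis.ValiantsHypothesis.Theorems.NewtonUnitEquationsDissociatedUniform

namespace TotalsLaw

/-! ### Intersecting pairs of two interval families of bounded ply -/

open Classical in
/-- **Two families of order-connected subsets of `ℝ` with plies `≤ k` (first family) and `≤ k'` (second) have at most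
`k'·#I + k·#K` intersecting pairs.**  For an intersecting pair take the later of the two earliest witnessed times; it lies in both
sets, and the pair is charged to the member whose earliest witness it is. [folklore] -/
theorem card_inter_pairs_le {ι κ : Type*} (I : Finset ι) (K : Finset κ)
    (T : ι → Set ℝ) (T' : κ → Set ℝ) (hT : ∀ i ∈ I, (T i).OrdConnected) (hT' : ∀ j ∈ K, (T' j).OrdConnected) (k k' : ℕ)
    (hk : ∀ t : ℝ, (I.filter fun i => t ∈ T i).card ≤ k) (hk' : ∀ t : ℝ, (K.filter fun j => t ∈ T' j).card ≤ k') :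
    ((I ×ˢ K).filter fun ij => (T ij.1 ∩ T' ij.2).Nonempty).card ≤ k' * I.card + k * K.card := by
  set P := (I ×ˢ K).filter fun ij => (T ij.1 ∩ T' ij.2).Nonempty with hPdef
  -- a witness time for every intersecting pair, and the finite set of witnesses
  have hw : ∀ p ∈ P, ∃ t : ℝ, t ∈ T p.1 ∧ t ∈ T' p.2 := fun p hp => (Finset.mem_filter.1 hp).2
  choose! w hw1 hw2 using hw
  set S : Finset ℝ := P.image w with hSdef
  -- earliest witnessed time of each member
  let s : ι → ℝ := fun i => if h : (S.filter fun t => t ∈ T i).Nonempty then (S.filter fun t => t ∈ T i).min' h else 0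
  let s' : κ → ℝ := fun j => if h : (S.filter fun t => t ∈ T' j).Nonempty then (S.filter fun t => t ∈ T' j).min' h else 0
  have hs : ∀ p ∈ P, s p.1 ∈ T p.1 ∧ s p.1 ≤ w p := by
    intro p hp
    have hmem : w p ∈ S.filter fun t => t ∈ T p.1 :=
      Finset.mem_filter.2 ⟨Finset.mem_image.2 ⟨p, hp, rfl⟩, hw1 p hp⟩
    have hne : (S.filter fun t => t ∈ T p.1).Nonempty := ⟨w p, hmem⟩
    have hdef : s p.1 = (S.filter fun t => t ∈ T p.1).min' hne := by simp only [s, dif_pos hne]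
    rw [hdef]
    exact ⟨(Finset.mem_filter.1 (Finset.min'_mem _ hne)).2, Finset.min'_le _ _ hmem⟩
  have hs' : ∀ p ∈ P, s' p.2 ∈ T' p.2 ∧ s' p.2 ≤ w p := by
    intro p hp
    have hmem : w p ∈ S.filter fun t => t ∈ T' p.2 :=
      Finset.mem_filter.2 ⟨Finset.mem_image.2 ⟨p, hp, rfl⟩, hw2 p hp⟩
    have hne : (S.filter fun t => t ∈ T' p.2).Nonempty := ⟨w p, hmem⟩
    have hdef : s' p.2 = (S.filter fun t => t ∈ T' p.2).min' hne := by simp only [s', dif_pos hne]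
    rw [hdef]
    exact ⟨(Finset.mem_filter.1 (Finset.min'_mem _ hne)).2, Finset.min'_le _ _ hmem⟩
  -- split by which earliest time is later
  set P₁ := P.filter fun p => s p.1 ≤ s' p.2 with hP₁
  set P₂ := P.filter fun p => ¬ s p.1 ≤ s' p.2 with hP₂
  have hsplit : P₁.card + P₂.card = P.card := Finset.card_filter_add_card_filter_not _
  -- pairs of the first kind: `s' j` lies in `T i`, charge to `j`
  have h1 : P₁ ⊆ K.biUnion fun j => (I.filter fun i => s' j ∈ T i).image fun i => (i, j) := by
    intro p hp
    obtain ⟨hpP, hle⟩ := Finset.mem_filter.1 hp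
    obtain ⟨hpIK, -⟩ := Finset.mem_filter.1 hpP
    obtain ⟨hi, hj⟩ := Finset.mem_product.1 hpIK
    rw [Finset.mem_biUnion]
    refine ⟨p.2, hj, Finset.mem_image.2 ⟨p.1, Finset.mem_filter.2 ⟨hi, ?_⟩, rfl⟩⟩
    obtain ⟨hsT, hsw⟩ := hs p hpP
    obtain ⟨hs'T, hs'w⟩ := hs' p hpP
    exact (hT p.1 hi).out hsT (hw1 p hpP) ⟨hle, hs'w⟩
  have h2 : P₂ ⊆ I.biUnion fun i => (K.filter fun j => s i ∈ T' j).image fun j => (i, j) := by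
    intro p hp
    obtain ⟨hpP, hlt⟩ := Finset.mem_filter.1 hp
    obtain ⟨hpIK, -⟩ := Finset.mem_filter.1 hpP
    obtain ⟨hi, hj⟩ := Finset.mem_product.1 hpIK
    rw [Finset.mem_biUnion]
    refine ⟨p.1, hi, Finset.mem_image.2 ⟨p.2, Finset.mem_filter.2 ⟨hj, ?_⟩, rfl⟩⟩
    obtain ⟨hsT, hsw⟩ := hs p hpP
    obtain ⟨hs'T, hs'w⟩ := hs' p hpP
    exact (hT' p.2 hj).out hs'T (hw2 p hpP) ⟨(not_le.1 hlt).le, hsw⟩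
  have hc1 : P₁.card ≤ k * K.card := by
    refine (Finset.card_le_card h1).trans ((Finset.card_biUnion_le).trans ?_)
    calc ∑ j ∈ K, ((I.filter fun i => s' j ∈ T i).image fun i => (i, j)).card ≤ ∑ _j ∈ K, k :=
          Finset.sum_le_sum fun j _ => Finset.card_image_le.trans (hk (s' j))
      _ = k * K.card := by rw [Finset.sum_const, smul_eq_mul, mul_comm]
  have hc2 : P₂.card ≤ k' * I.card := by
    refine (Finset.card_le_card h2).trans ((Finset.card_biUnion_le).trans ?_)
    calc ∑ i ∈ I, ((K.filter fun j => s i ∈ T' j).image fun j => (i, j)).card ≤ ∑ _i ∈ I, k' :=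
          Finset.sum_le_sum fun i _ => Finset.card_image_le.trans (hk' (s i))
      _ = k' * I.card := by rw [Finset.sum_const, smul_eq_mul, mul_comm]
  omega

/-! ### Local-maximum times along a chart are order-connected -/

section Modality

variable {q : ℕ} [NeZero q]

/-- The set of chart times at which the label `x` is a label-local maximum of `⟨(σ, ·), a ·⟩`. -/
def localMaxTimes (a : ZMod q → (Fin 2 → ℝ)) (σ : ℝ) (x : ZMod q) : Set ℝ :=
  {t | x ∈ localMax fun y => ![σ, t] ⬝ᵥ a y}

/-- Membership: two affine sign conditions. [folklore] -/
theorem mem_localMaxTimes {a : ZMod q → (Fin 2 → ℝ)} {σ : ℝ} {x : ZMod q} {t : ℝ} :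
    t ∈ localMaxTimes a σ x ↔ ![σ, t] ⬝ᵥ a (x - 1) ≤ ![σ, t] ⬝ᵥ a x ∧ ![σ, t] ⬝ᵥ a (x + 1) ≤ ![σ, t] ⬝ᵥ a x := by
  unfold localMaxTimes localMax
  rw [Set.mem_setOf_eq, Finset.mem_filter]
  simp

/-- **The local-maximum times of a label form an order-connected set** (each condition is affine in `t`). [folklore] -/
theorem ordConnected_localMaxTimes (a : ZMod q → (Fin 2 → ℝ)) (σ : ℝ) (x : ZMod q) : (localMaxTimes a σ x).OrdConnected := by
  refine ⟨fun t₁ ht₁ t₂ ht₂ t ht => ?_⟩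
  rw [mem_localMaxTimes] at ht₁ ht₂ ⊢
  obtain ⟨h1, h2⟩ := ht
  simp only [chart_dotProduct] at ht₁ ht₂ ⊢
  obtain ⟨a1, a2⟩ := ht₁
  obtain ⟨b1, b2⟩ := ht₂
  constructor
  · -- the affine function `t ↦ σ (Δ₀) + t Δ₁` is nonnegative at `t₁` and `t₂`, hence in between
    by_cases hd : a x 1 - a (x - 1) 1 ≥ 0
    · nlinarith
    · nlinarith
  · by_cases hd : a x 1 - a (x + 1) 1 ≥ 0
    · nlinarith
    · nlinarith

variable (a b : ZMod q → (Fin 2 → ℝ))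

/-- **`#localMaxPairs ≤ 2 (k_A + k_B) q` for labellings of modality `k_A`, `k_B`** (at most `k_A`, resp. `k_B`, label-local maxima
along every chart weight). [folklore] -/
theorem card_localMaxPairs_le_of_modality {kA kB : ℕ}
    (hA : ∀ σ t : ℝ, (σ = 1 ∨ σ = -1) → (localMax fun x => ![σ, t] ⬝ᵥ a x).card ≤ kA)
    (hB : ∀ σ t : ℝ, (σ = 1 ∨ σ = -1) → (localMax fun y => ![σ, t] ⬝ᵥ b y).card ≤ kB) :
    (localMaxPairs a b).card ≤ 2 * ((kB + kA) * q) := by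
  classical
  -- per chart: the intersecting pairs of the two families of local-maximum time sets
  have hchart : ∀ σ : ℝ, (σ = 1 ∨ σ = -1) →
      ((Finset.univ ×ˢ Finset.univ).filter fun xy : ZMod q × ZMod q =>
        (localMaxTimes a σ xy.1 ∩ localMaxTimes b σ xy.2).Nonempty).card ≤ kB * q + kA * q := by
    intro σ hσ
    have hkA : ∀ t : ℝ, (Finset.univ.filter fun x : ZMod q => t ∈ localMaxTimes a σ x).card ≤ kA := by
      intro t
      have : (Finset.univ.filter fun x : ZMod q => t ∈ localMaxTimes a σ x) = localMax fun y => ![σ, t] ⬝ᵥ a y := by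
        ext x
        simp [localMaxTimes, localMax]
      rw [this]; exact hA σ t hσ
    have hkB : ∀ t : ℝ, (Finset.univ.filter fun y : ZMod q => t ∈ localMaxTimes b σ y).card ≤ kB := by
      intro t
      have : (Finset.univ.filter fun y : ZMod q => t ∈ localMaxTimes b σ y) = localMax fun y => ![σ, t] ⬝ᵥ b y := by
        ext y
        simp [localMaxTimes, localMax]
      rw [this]; exact hB σ t hσ
    have h := card_inter_pairs_le (Finset.univ : Finset (ZMod q)) (Finset.univ : Finset (ZMod q))
      (localMaxTimes a σ) (localMaxTimes b σ) (fun x _ => ordConnected_localMaxTimes a σ x)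
      (fun y _ => ordConnected_localMaxTimes b σ y) kA kB hkA hkB
    simpa [Finset.card_univ, ZMod.card] using h
  -- the local-maximum pairs are intersecting pairs along one of the two charts
  have hsub : localMaxPairs a b ⊆
      ((Finset.univ ×ˢ Finset.univ).filter fun xy : ZMod q × ZMod q =>
        (localMaxTimes a 1 xy.1 ∩ localMaxTimes b 1 xy.2).Nonempty) ∪
      ((Finset.univ ×ˢ Finset.univ).filter fun xy : ZMod q × ZMod q =>
        (localMaxTimes a (-1) xy.1 ∩ localMaxTimes b (-1) xy.2).Nonempty) := by
    intro xy hxy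
    unfold localMaxPairs at hxy
    obtain ⟨-, σ, t, hσ, hx, hy⟩ := Finset.mem_filter.1 hxy
    rw [Finset.mem_union, Finset.mem_filter, Finset.mem_filter]
    rcases hσ with rfl | rfl
    · exact Or.inl ⟨Finset.mem_product.2 ⟨Finset.mem_univ _, Finset.mem_univ _⟩, t, hx, hy⟩
    · exact Or.inr ⟨Finset.mem_product.2 ⟨Finset.mem_univ _, Finset.mem_univ _⟩, t, hx, hy⟩
  calc (localMaxPairs a b).card ≤ _ := Finset.card_le_card hsub
    _ ≤ _ := Finset.card_union_le _ _
    _ ≤ (kB * q + kA * q) + (kB * q + kA * q) := add_le_add (hchart 1 (Or.inl rfl)) (hchart (-1) (Or.inr rfl))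
    _ = 2 * ((kB + kA) * q) := by ring

/-- **The union totals law for labellings of bounded modality**: if `⟨w, a·⟩`, `⟨w, b·⟩` have at most `k_A`, `k_B` label-local
maxima along every chart weight `w = (±1, t)`, then `unionTotal a b Z ≤ 2 (k_A + k_B) q² + #bdry Z · V_P` for every position set `Z`.
[folklore] -/
theorem unionTotal_le_of_modality {kA kB : ℕ}
    (hA : ∀ σ t : ℝ, (σ = 1 ∨ σ = -1) → (localMax fun x => ![σ, t] ⬝ᵥ a x).card ≤ kA)
    (hB : ∀ σ t : ℝ, (σ = 1 ∨ σ = -1) → (localMax fun y => ![σ, t] ⬝ᵥ b y).card ≤ kB) (Z : Finset (ZMod q)) :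
    unionTotal a b (Z : Set (ZMod q)) ≤ 2 * (kA + kB) * q ^ 2 + (bdry Z).card * fibreTotal a b := by
  have h1 := unionTotal_le_of_localMaxPairs a b Z
  have h2 := card_localMaxPairs_le_of_modality a b hA hB
  calc unionTotal a b (Z : Set (ZMod q)) ≤ q * (localMaxPairs a b).card + (bdry Z).card * fibreTotal a b := h1
    _ ≤ q * (2 * ((kB + kA) * q)) + (bdry Z).card * fibreTotal a b := by gcongr
    _ = 2 * (kA + kB) * q ^ 2 + (bdry Z).card * fibreTotal a b := by ring

/-- Pointwise form: `#vert conv U_s(Z) ≤ 2 (k_A + k_B) q + ∑_{z ∈ bdry Z} V(P_{s-z})`. [folklore] -/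
theorem unionVert_le_of_modality {kA kB : ℕ}
    (hA : ∀ σ t : ℝ, (σ = 1 ∨ σ = -1) → (localMax fun x => ![σ, t] ⬝ᵥ a x).card ≤ kA)
    (hB : ∀ σ t : ℝ, (σ = 1 ∨ σ = -1) → (localMax fun y => ![σ, t] ⬝ᵥ b y).card ≤ kB) (Z : Finset (ZMod q)) (s : ZMod q) :
    unionVert a b (Z : Set (ZMod q)) s ≤ 2 * (kA + kB) * q + ∑ z ∈ bdry Z, fibreVert a b (s - z) := by
  have h1 := unionVert_le_card_localMaxPairs_add a b Z s
  have h2 := card_localMaxPairs_le_of_modality a b hA hB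
  calc unionVert a b (Z : Set (ZMod q)) s ≤ (localMaxPairs a b).card + ∑ z ∈ bdry Z, fibreVert a b (s - z) := h1
    _ ≤ 2 * ((kB + kA) * q) + ∑ z ∈ bdry Z, fibreVert a b (s - z) := by gcongr
    _ = 2 * (kA + kB) * q + ∑ z ∈ bdry Z, fibreVert a b (s - z) := by ring

end Modality

end TotalsLaw

end Summit.ValiantsHypothesis.ValiantsHypothesis.Theorems.NewtonUnitEquationsDissociatedUniform
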